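import Summits.HubbardSuperconductivity.HubbardSuperconductivity.Theorems.KLProgrammeKLRegimeFlowReadScaleZeroDiagonalSplit

/-!
# Route `KLProgramme`, crux K3 — ENGINE (stmt-HubbardSuperconductivity-20437), row (C) credit path, GAP **G-005** «(C)-TADPOLE-NONVANISHING»:
# OWNER LEMMA, PART 1 — the diagonal constant of record `c_e` is the first-order Hartree constant `−U·T₀` up to `O(U²)`

Seat hubbard-kl-k3c5-p1 (g19; writer of the G-005 owner lemma, pen (R435)(B)/(R436)(B); p1b g18 x-reads).  «G005-SHORT-ROAD»: at ORDER ZERO the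
split `W₀ = W_a″ + S + Q_c + D_e` of `…FlowReadScaleZeroAssembly` gives the STRUCTURED value of `ν₀(θ) = klLocalPart L M β U μ 0 0 θ` about the
first-order constant.  `T₀ := Re Σ_k (βL²)⁻²Ψ⁰(k,0)` (REAL, `= L⁻²·`UV Hartree sum by `…ScaleZeroTadpoleBridge`; `≥ 1/128` on the regime by
`…ScaleZeroTadpoleRegime`), `ε = β/4M`.
* §1 `norm_diagCoeff_sub_firstOrder_le`, **`abs_diagConst_add_firstOrder_le`**: `|c_e + U·T₀| ≤ 2048·U² + 64·U²·ε` for the constant of record `c_e`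
  of `…DiagonalSplit` (its first-order term `(Uε)·t`, `t = −Σ(βL²)⁻²Ψ⁰`, sums over the `4M·L²` grid points to `U·t` exactly).
Part 2 (`…ScaleZeroReadFirstOrder`): the owner lemma `|ν₀(θ) + U·T₀| ≤ 2tv|U| + (2tb₀ + bSA + a₀ + 2048 + 64ε)U²` in the currency of
`twoLegRead_frameZero_of_sunsetData`, then G-005 by route (B).  Proofs only; no definitions; the rows are
HYPOTHESES; nothing here asserts G-005, (C), any stub of 20437, K3 or superconductivity.
References: BGM 2006 §2.1 (2.3)–(2.6), §2.3–§2.4 [cite: BenfattoGiulianiMastropietro2006].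
-/

noncomputable section

namespace Summit.HubbardSuperconductivity.HubbardSuperconductivity.Theorems.KLRegimeSplit

set_option linter.dupNamespace false -- summit = problem name (single-conjunct summit), D-0017

open Real Finset Complex Literature.MathematicalPhysics.QuantumLattice Literature.Probability.LatticeModels GrassmannAlgebra Matrix
open Summit.HubbardSuperconductivity.HubbardSuperconductivity.Theorems.EngineV8
open scoped Nat

/-! ## §1 The constant of record is `−U·T₀` to second order -/

section Const

variable {L M : ℕ} [NeZero L] [NeZero M]

/-- **The coefficient of record minus its first-order term** is `O(U²ε)`: `‖e(p,σ) − (Uε)·t‖ ≤ 2048·U²ε + 64·U²ε²`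
(`t = −Σ_k (βL²)⁻²Ψ⁰(k,0)`, `|t| ≤ 4`; the swap sum `≤ 512/ε`). [cite: BenfattoGiulianiMastropietro2006, §2.3] -/
theorem norm_diagCoeff_sub_firstOrder_le {β : ℝ} (hβ : 0 < β) (U μ : ℝ) (p : GridPoint L (2 * (2 * M))) (σ : Fin 2) :
    ‖((2 : ℂ) * ((2 : ℂ)⁻¹ * (((U * (β / (2 * (2 * M) : ℕ)) : ℝ) : ℂ) *
        (-∑ k : FreqMomentum L M, ((1 / (β * (L : ℝ) ^ 2) : ℝ) : ℂ) ^ 2 * uvSymbolCT L M β μ 0 klE0 (k, 0))) +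
      (2 : ℂ)⁻¹ * (((U * (β / (2 * (2 * M) : ℕ)) : ℝ) : ℂ) ^ 2 *
        ((-∑ k : FreqMomentum L M, ((1 / (β * (L : ℝ) ^ 2) : ℝ) : ℂ) ^ 2 * uvSymbolCT L M β μ 0 klE0 (k, 0)) *
          ∑ q : GridPoint L (2 * (2 * M)),
            contr ℂ ((hubbardGridSub L M β (2 * (2 * M))).transpose * hubbardCovAboveCT L M β μ 0 0 klE0 *
                hubbardGridSub L M β (2 * (2 * M))) (((p, σ.rev), 0) : GridLeg (GridPoint L (2 * (2 * M)))) ((q, σ.rev), 1) *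
              contr ℂ ((hubbardGridSub L M β (2 * (2 * M))).transpose * hubbardCovAboveCT L M β μ 0 0 klE0 *
                hubbardGridSub L M β (2 * (2 * M))) (((q, σ.rev), 0) : GridLeg (GridPoint L (2 * (2 * M)))) ((p, σ.rev), 1))) -
      (2 : ℂ)⁻¹ * ((((U * (β / (2 * (2 * M) : ℕ)) : ℝ) : ℂ) ^ 2 *
          ((-∑ k : FreqMomentum L M, ((1 / (β * (L : ℝ) ^ 2) : ℝ) : ℂ) ^ 2 * uvSymbolCT L M β μ 0 klE0 (k, 0)) *
           (-∑ k : FreqMomentum L M, ((1 / (β * (L : ℝ) ^ 2) : ℝ) : ℂ) ^ 2 * uvSymbolCT L M β μ 0 klE0 (k, 0)))) *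
        (-∑ k : FreqMomentum L M, ((1 / (β * (L : ℝ) ^ 2) : ℝ) : ℂ) ^ 2 * uvSymbolCT L M β μ 0 klE0 (k, 0))))) -
      ((U * (β / (2 * (2 * M) : ℕ)) : ℝ) : ℂ) * (-∑ k : FreqMomentum L M, ((1 / (β * (L : ℝ) ^ 2) : ℝ) : ℂ) ^ 2 * uvSymbolCT L M β μ 0 klE0 (k, 0))‖ ≤
      2048 * U ^ 2 * (β / ((2 * (2 * M) : ℕ) : ℝ)) + 64 * U ^ 2 * (β / ((2 * (2 * M) : ℕ) : ℝ)) ^ 2 := by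
  have hN : (0 : ℝ) < ((2 * (2 * M) : ℕ) : ℝ) := by have := NeZero.ne M; positivity
  set ε : ℝ := β / ((2 * (2 * M) : ℕ) : ℝ) with hε
  have hε0 : 0 < ε := by positivity
  set t : ℂ := -∑ k : FreqMomentum L M, ((1 / (β * (L : ℝ) ^ 2) : ℝ) : ℂ) ^ 2 * uvSymbolCT L M β μ 0 klE0 (k, 0) with ht
  set R : ℂ := ∑ q : GridPoint L (2 * (2 * M)),
      contr ℂ ((hubbardGridSub L M β (2 * (2 * M))).transpose * hubbardCovAboveCT L M β μ 0 0 klE0 *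
          hubbardGridSub L M β (2 * (2 * M))) (((p, σ.rev), 0) : GridLeg (GridPoint L (2 * (2 * M)))) ((q, σ.rev), 1) *
        contr ℂ ((hubbardGridSub L M β (2 * (2 * M))).transpose * hubbardCovAboveCT L M β μ 0 0 klE0 *
          hubbardGridSub L M β (2 * (2 * M))) (((q, σ.rev), 0) : GridLeg (GridPoint L (2 * (2 * M)))) ((p, σ.rev), 1) with hR
  have htn : ‖t‖ ≤ 4 := by rw [ht, norm_neg]; exact norm_scaleZero_tadpole_le_four hβ μ 0
  have hRn : ‖R‖ ≤ 512 / ε := by rw [hR, hε]; exact norm_sum_scaleZeroGridCov_mul_swap_le hβ μ p σ.rev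
  have hUε : ‖(((U * ε : ℝ)) : ℂ)‖ = |U| * ε := by rw [Complex.norm_real, Real.norm_eq_abs, abs_mul, abs_of_pos hε0]
  have e2 : ‖(((U * ε : ℝ)) : ℂ) ^ 2 * (t * R)‖ ≤ 2048 * U ^ 2 * ε := by
    rw [norm_mul, norm_mul, norm_pow, hUε]
    calc (|U| * ε) ^ 2 * (‖t‖ * ‖R‖) ≤ (|U| * ε) ^ 2 * (4 * (512 / ε)) :=
          mul_le_mul_of_nonneg_left (mul_le_mul htn hRn (norm_nonneg _) (by norm_num)) (by positivity)
      _ = 2048 * U ^ 2 * ε := by rw [mul_pow, sq_abs]; field_simp; ring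
  have e3 : ‖(((U * ε : ℝ)) : ℂ) ^ 2 * (t * t * t)‖ ≤ 64 * U ^ 2 * ε ^ 2 := by
    rw [norm_mul, norm_mul, norm_mul, norm_pow, hUε]
    have ht3 : ‖t‖ * ‖t‖ * ‖t‖ ≤ 4 * 4 * 4 :=
      mul_le_mul (mul_le_mul htn htn (norm_nonneg _) (by norm_num)) htn (norm_nonneg _) (by norm_num)
    calc (|U| * ε) ^ 2 * (‖t‖ * ‖t‖ * ‖t‖) ≤ (|U| * ε) ^ 2 * (4 * 4 * 4) := mul_le_mul_of_nonneg_left ht3 (by positivity)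
      _ = 64 * U ^ 2 * ε ^ 2 := by rw [mul_pow, sq_abs]; ring
  have hsplit : (2 : ℂ) * ((2 : ℂ)⁻¹ * ((((U * ε : ℝ)) : ℂ) * t) + (2 : ℂ)⁻¹ * ((((U * ε : ℝ)) : ℂ) ^ 2 * (t * R)) -
      (2 : ℂ)⁻¹ * ((((U * ε : ℝ)) : ℂ) ^ 2 * (t * t) * t)) - (((U * ε : ℝ)) : ℂ) * t =
      (((U * ε : ℝ)) : ℂ) ^ 2 * (t * R) - (((U * ε : ℝ)) : ℂ) ^ 2 * (t * t * t) := by ring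
  rw [hsplit]
  exact (norm_sub_le _ _).trans (add_le_add e2 e3)

/-- **`c_e` IS `−U·T₀` TO SECOND ORDER**: `|c_e + U·T₀| ≤ 2048·U² + 64·U²·ε`, `T₀ = Re Σ_k (βL²)⁻²Ψ⁰(k,0)`, for the constant of record
`c_e = (Σ_σ Re((βL²)⁻¹Σ_p e(p,σ)))/2` of `…DiagonalSplit` (`0 < β`): the first-order term sums to `(βL²)⁻¹·4ML²·(Uβ/4M)·t = U·t`, `t = −Σ(βL²)⁻²Ψ⁰`.
[cite: BenfattoGiulianiMastropietro2006, §2.3] -/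
theorem abs_diagConst_add_firstOrder_le {β : ℝ} (hβ : 0 < β) (U μ : ℝ) :
    |(∑ σ : Fin 2, ((((1 / (β * (L : ℝ) ^ 2) : ℝ) : ℂ)) * ∑ p : GridPoint L (2 * (2 * M)),
      ((2 : ℂ) * ((2 : ℂ)⁻¹ * (((U * (β / (2 * (2 * M) : ℕ)) : ℝ) : ℂ) *
        (-∑ k : FreqMomentum L M, ((1 / (β * (L : ℝ) ^ 2) : ℝ) : ℂ) ^ 2 * uvSymbolCT L M β μ 0 klE0 (k, 0))) +
      (2 : ℂ)⁻¹ * (((U * (β / (2 * (2 * M) : ℕ)) : ℝ) : ℂ) ^ 2 *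
        ((-∑ k : FreqMomentum L M, ((1 / (β * (L : ℝ) ^ 2) : ℝ) : ℂ) ^ 2 * uvSymbolCT L M β μ 0 klE0 (k, 0)) *
          ∑ q : GridPoint L (2 * (2 * M)),
            contr ℂ ((hubbardGridSub L M β (2 * (2 * M))).transpose * hubbardCovAboveCT L M β μ 0 0 klE0 *
                hubbardGridSub L M β (2 * (2 * M))) (((p, σ.rev), 0) : GridLeg (GridPoint L (2 * (2 * M)))) ((q, σ.rev), 1) *
              contr ℂ ((hubbardGridSub L M β (2 * (2 * M))).transpose * hubbardCovAboveCT L M β μ 0 0 klE0 *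
                hubbardGridSub L M β (2 * (2 * M))) (((q, σ.rev), 0) : GridLeg (GridPoint L (2 * (2 * M)))) ((p, σ.rev), 1))) -
      (2 : ℂ)⁻¹ * ((((U * (β / (2 * (2 * M) : ℕ)) : ℝ) : ℂ) ^ 2 *
          ((-∑ k : FreqMomentum L M, ((1 / (β * (L : ℝ) ^ 2) : ℝ) : ℂ) ^ 2 * uvSymbolCT L M β μ 0 klE0 (k, 0)) *
           (-∑ k : FreqMomentum L M, ((1 / (β * (L : ℝ) ^ 2) : ℝ) : ℂ) ^ 2 * uvSymbolCT L M β μ 0 klE0 (k, 0)))) *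
        (-∑ k : FreqMomentum L M, ((1 / (β * (L : ℝ) ^ 2) : ℝ) : ℂ) ^ 2 * uvSymbolCT L M β μ 0 klE0 (k, 0)))))).re) / 2 +
      U * (∑ k : FreqMomentum L M, ((1 / (β * (L : ℝ) ^ 2) : ℝ) : ℂ) ^ 2 * uvSymbolCT L M β μ 0 klE0 (k, 0)).re| ≤
      2048 * U ^ 2 + 64 * U ^ 2 * (β / ((2 * (2 * M) : ℕ) : ℝ)) := by
  have hL : (0 : ℝ) < (L : ℝ) := by have := NeZero.ne L; positivity
  have hβL : 0 < β * (L : ℝ) ^ 2 := by positivity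
  have hN : (0 : ℝ) < ((2 * (2 * M) : ℕ) : ℝ) := by have := NeZero.ne M; positivity
  set ε : ℝ := β / ((2 * (2 * M) : ℕ) : ℝ) with hε
  set t : ℂ := -∑ k : FreqMomentum L M, ((1 / (β * (L : ℝ) ^ 2) : ℝ) : ℂ) ^ 2 * uvSymbolCT L M β μ 0 klE0 (k, 0) with ht
  set u : ℂ := (((1 / (β * (L : ℝ) ^ 2) : ℝ) : ℂ)) with hu_def
  have hcard : (Fintype.card (GridPoint L (2 * (2 * M))) : ℝ) = ((2 * (2 * M) : ℕ) : ℝ) * (L : ℝ) ^ 2 := by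
    simp [GridPoint, TorusSite, Fintype.card_prod, Fintype.card_fin, ZMod.card]
  have hu : ‖u‖ = 1 / (β * (L : ℝ) ^ 2) := by
    rw [hu_def, Complex.norm_real, Real.norm_eq_abs, abs_of_pos (by positivity)]
  -- the first-order term summed over the grid is `U·t`
  have hfirst : u * ∑ _p : GridPoint L (2 * (2 * M)), (((U * ε : ℝ)) : ℂ) * t = ((U : ℝ) : ℂ) * t := by
    rw [Finset.sum_const, Finset.card_univ, nsmul_eq_mul]
    have hc : ((Fintype.card (GridPoint L (2 * (2 * M))) : ℕ) : ℂ) = ((((2 * (2 * M) : ℕ) : ℝ) * (L : ℝ) ^ 2 : ℝ) : ℂ) := by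
      rw [← hcard]; push_cast; rfl
    rw [hc, hu_def, hε]
    have hβc : ((β : ℝ) : ℂ) ≠ 0 := by exact_mod_cast hβ.ne'
    have hLc : ((L : ℝ) : ℂ) ≠ 0 := by exact_mod_cast hL.ne'
    have hMc : ((((2 * (2 * M) : ℕ) : ℝ)) : ℂ) ≠ 0 := by exact_mod_cast hN.ne'
    have hM0 : ((M : ℕ) : ℂ) ≠ 0 := by exact_mod_cast (NeZero.ne M)
    push_cast at hβc hLc hMc ⊢
    field_simp
  have hre : (((U : ℝ) : ℂ) * t).re = -(U * (∑ k : FreqMomentum L M, ((1 / (β * (L : ℝ) ^ 2) : ℝ) : ℂ) ^ 2 * uvSymbolCT L M β μ 0 klE0 (k, 0)).re) := by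
    rw [ht, Complex.re_ofReal_mul, Complex.neg_re]; ring
  -- each spin block: the remainder after the first-order term
  have hblock : ∀ σ : Fin 2, ‖u * ∑ p : GridPoint L (2 * (2 * M)),
      (((2 : ℂ) * ((2 : ℂ)⁻¹ * (((U * (β / (2 * (2 * M) : ℕ)) : ℝ) : ℂ) *
          (-∑ k : FreqMomentum L M, ((1 / (β * (L : ℝ) ^ 2) : ℝ) : ℂ) ^ 2 * uvSymbolCT L M β μ 0 klE0 (k, 0))) +
        (2 : ℂ)⁻¹ * (((U * (β / (2 * (2 * M) : ℕ)) : ℝ) : ℂ) ^ 2 *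
          ((-∑ k : FreqMomentum L M, ((1 / (β * (L : ℝ) ^ 2) : ℝ) : ℂ) ^ 2 * uvSymbolCT L M β μ 0 klE0 (k, 0)) *
            ∑ q : GridPoint L (2 * (2 * M)),
              contr ℂ ((hubbardGridSub L M β (2 * (2 * M))).transpose * hubbardCovAboveCT L M β μ 0 0 klE0 *
                  hubbardGridSub L M β (2 * (2 * M))) (((p, σ.rev), 0) : GridLeg (GridPoint L (2 * (2 * M)))) ((q, σ.rev), 1) *
                contr ℂ ((hubbardGridSub L M β (2 * (2 * M))).transpose * hubbardCovAboveCT L M β μ 0 0 klE0 *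
                  hubbardGridSub L M β (2 * (2 * M))) (((q, σ.rev), 0) : GridLeg (GridPoint L (2 * (2 * M)))) ((p, σ.rev), 1))) -
        (2 : ℂ)⁻¹ * ((((U * (β / (2 * (2 * M) : ℕ)) : ℝ) : ℂ) ^ 2 *
            ((-∑ k : FreqMomentum L M, ((1 / (β * (L : ℝ) ^ 2) : ℝ) : ℂ) ^ 2 * uvSymbolCT L M β μ 0 klE0 (k, 0)) *
             (-∑ k : FreqMomentum L M, ((1 / (β * (L : ℝ) ^ 2) : ℝ) : ℂ) ^ 2 * uvSymbolCT L M β μ 0 klE0 (k, 0)))) *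
          (-∑ k : FreqMomentum L M, ((1 / (β * (L : ℝ) ^ 2) : ℝ) : ℂ) ^ 2 * uvSymbolCT L M β μ 0 klE0 (k, 0))))) - (((U * ε : ℝ)) : ℂ) * t)‖ ≤ 2048 * U ^ 2 + 64 * U ^ 2 * ε := by
    intro σ
    rw [norm_mul, hu]
    have hsum := (norm_sum_le _ _).trans (Finset.sum_le_sum fun p (_ : p ∈ (Finset.univ : Finset (GridPoint L (2 * (2 * M))))) =>
      norm_diagCoeff_sub_firstOrder_le (L := L) (M := M) hβ U μ p σ)
    rw [Finset.sum_const, Finset.card_univ, nsmul_eq_mul, hcard] at hsum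
    refine (mul_le_mul_of_nonneg_left hsum (by positivity)).trans (le_of_eq ?_)
    rw [hε]
    field_simp
  -- assemble: `c_e + U·T₀ = (Σ_σ Re(u·Σ_p (e − (Uε)t)))/2`
  have hkey : ∀ σ : Fin 2, (u * ∑ p : GridPoint L (2 * (2 * M)), ((2 : ℂ) * ((2 : ℂ)⁻¹ * (((U * (β / (2 * (2 * M) : ℕ)) : ℝ) : ℂ) *
          (-∑ k : FreqMomentum L M, ((1 / (β * (L : ℝ) ^ 2) : ℝ) : ℂ) ^ 2 * uvSymbolCT L M β μ 0 klE0 (k, 0))) +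
        (2 : ℂ)⁻¹ * (((U * (β / (2 * (2 * M) : ℕ)) : ℝ) : ℂ) ^ 2 *
          ((-∑ k : FreqMomentum L M, ((1 / (β * (L : ℝ) ^ 2) : ℝ) : ℂ) ^ 2 * uvSymbolCT L M β μ 0 klE0 (k, 0)) *
            ∑ q : GridPoint L (2 * (2 * M)),
              contr ℂ ((hubbardGridSub L M β (2 * (2 * M))).transpose * hubbardCovAboveCT L M β μ 0 0 klE0 *
                  hubbardGridSub L M β (2 * (2 * M))) (((p, σ.rev), 0) : GridLeg (GridPoint L (2 * (2 * M)))) ((q, σ.rev), 1) *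
                contr ℂ ((hubbardGridSub L M β (2 * (2 * M))).transpose * hubbardCovAboveCT L M β μ 0 0 klE0 *
                  hubbardGridSub L M β (2 * (2 * M))) (((q, σ.rev), 0) : GridLeg (GridPoint L (2 * (2 * M)))) ((p, σ.rev), 1))) -
        (2 : ℂ)⁻¹ * ((((U * (β / (2 * (2 * M) : ℕ)) : ℝ) : ℂ) ^ 2 *
            ((-∑ k : FreqMomentum L M, ((1 / (β * (L : ℝ) ^ 2) : ℝ) : ℂ) ^ 2 * uvSymbolCT L M β μ 0 klE0 (k, 0)) *
             (-∑ k : FreqMomentum L M, ((1 / (β * (L : ℝ) ^ 2) : ℝ) : ℂ) ^ 2 * uvSymbolCT L M β μ 0 klE0 (k, 0)))) *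
          (-∑ k : FreqMomentum L M, ((1 / (β * (L : ℝ) ^ 2) : ℝ) : ℂ) ^ 2 * uvSymbolCT L M β μ 0 klE0 (k, 0)))))).re + U * (∑ k : FreqMomentum L M, ((1 / (β * (L : ℝ) ^ 2) : ℝ) : ℂ) ^ 2 * uvSymbolCT L M β μ 0 klE0 (k, 0)).re =
      (u * ∑ p : GridPoint L (2 * (2 * M)), (((2 : ℂ) * ((2 : ℂ)⁻¹ * (((U * (β / (2 * (2 * M) : ℕ)) : ℝ) : ℂ) *
          (-∑ k : FreqMomentum L M, ((1 / (β * (L : ℝ) ^ 2) : ℝ) : ℂ) ^ 2 * uvSymbolCT L M β μ 0 klE0 (k, 0))) +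
        (2 : ℂ)⁻¹ * (((U * (β / (2 * (2 * M) : ℕ)) : ℝ) : ℂ) ^ 2 *
          ((-∑ k : FreqMomentum L M, ((1 / (β * (L : ℝ) ^ 2) : ℝ) : ℂ) ^ 2 * uvSymbolCT L M β μ 0 klE0 (k, 0)) *
            ∑ q : GridPoint L (2 * (2 * M)),
              contr ℂ ((hubbardGridSub L M β (2 * (2 * M))).transpose * hubbardCovAboveCT L M β μ 0 0 klE0 *
                  hubbardGridSub L M β (2 * (2 * M))) (((p, σ.rev), 0) : GridLeg (GridPoint L (2 * (2 * M)))) ((q, σ.rev), 1) *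
                contr ℂ ((hubbardGridSub L M β (2 * (2 * M))).transpose * hubbardCovAboveCT L M β μ 0 0 klE0 *
                  hubbardGridSub L M β (2 * (2 * M))) (((q, σ.rev), 0) : GridLeg (GridPoint L (2 * (2 * M)))) ((p, σ.rev), 1))) -
        (2 : ℂ)⁻¹ * ((((U * (β / (2 * (2 * M) : ℕ)) : ℝ) : ℂ) ^ 2 *
            ((-∑ k : FreqMomentum L M, ((1 / (β * (L : ℝ) ^ 2) : ℝ) : ℂ) ^ 2 * uvSymbolCT L M β μ 0 klE0 (k, 0)) *
             (-∑ k : FreqMomentum L M, ((1 / (β * (L : ℝ) ^ 2) : ℝ) : ℂ) ^ 2 * uvSymbolCT L M β μ 0 klE0 (k, 0)))) *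
          (-∑ k : FreqMomentum L M, ((1 / (β * (L : ℝ) ^ 2) : ℝ) : ℂ) ^ 2 * uvSymbolCT L M β μ 0 klE0 (k, 0))))) - (((U * ε : ℝ)) : ℂ) * t)).re := by
    intro σ
    rw [Finset.sum_sub_distrib, mul_sub, Complex.sub_re, hfirst, hre]
    ring
  have h0 := (Complex.abs_re_le_norm _).trans (hblock 0)
  have h1 := (Complex.abs_re_le_norm _).trans (hblock 1)
  rw [← hkey 0] at h0
  rw [← hkey 1] at h1
  rw [Fin.sum_univ_two]
  rw [abs_le] at h0 h1 ⊢
  constructor <;> linarith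

end Const

end Summit.HubbardSuperconductivity.HubbardSuperconductivity.Theorems.KLRegimeSplit

end
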